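import Summits.QuantumFields.YangMills.Theorems.LangevinControlUVOSLegsFromFemtoAndGapStubCollar6
import Summits.QuantumFields.YangMills.Theorems.LangevinControlUVOSLegsFromFemtoAndGapStubAssemblyMomentWeights
import HarnessLib

/-!
# Soft OS-assembly toolkit IX: the plane expansion `MomentBounds6 ⇒ MomentBounds`

Helper file for stub `stub_assembly6` of crux `OSLegsFromFemtoAndGap` (stmt-QuantumFields-9367, line
`dlr-collar-transfer`, reshape r2).  The action density is the sum of the six single-plane fields
(`dens x = Σ_{i<j} plane (i, j) x`), so its centred `n`-th torus moment expands into `6ⁿ` centred mixed moments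
of plane strings; the plane-resolved collar output `MomentBounds6` (constant `C`) therefore gives the density
collar output `MomentBounds` with constant `6C` (`momentBounds_of_momentBounds6`).  This is what lets every
density-only toolkit (VI-c a-uniform bound, VII limits, XIII soft legs) run under the hypotheses of
`Statement.stub_assembly6`.
-/

noncomputable section

open scoped BigOperators
open MeasureTheory Filter Topology
open Literature.MathematicalPhysics.QuantumFieldTheory Literature.MathematicalPhysics.QuantumLattice
open Literature.Probability.LatticeModels (Site)
open Summit.QuantumFields.YangMills.Cruxes.OSLegsFromFemtoAndGap.DlrCollarTransfer
  (torusE dens plane MomentBounds MomentBounds6 continuous_plane exists_abs_plane_le)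

namespace Summit.QuantumFields.YangMills.Theorems.OSLegsFromFemtoAndGap

variable {G : Type} [Group G] [TopologicalSpace G] [IsTopologicalGroup G] [CompactSpace G]
  [MeasurableSpace G] [BorelSpace G]

/-- The set of plaquette orientations `{(i, j) : i < j}`. -/
theorem card_planes : (Finset.univ.filter fun q : Fin 4 × Fin 4 => q.1 < q.2).card = 6 := by decide

/-- **The density is the sum of the six plane fields** (as a sum over the orientation set). -/
theorem dens_eq_sum_filter_plane (r : LatticeRep G) (x : Fin 4 → ℤ) (U : LGConfig 4 G) :
    dens G r x U = ∑ q ∈ Finset.univ.filter (fun q : Fin 4 × Fin 4 => q.1 < q.2), plane G r q x U := by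
  rw [Finset.sum_filter, ← Finset.univ_product_univ, Finset.sum_product]
  rfl

/-- Measurability of the plane fields read through the periodic lift. -/
theorem measurable_plane_lift (r : LatticeRep G) (L : ℕ) (q : Fin 4 × Fin 4) (x : Fin 4 → ℤ) :
    Measurable fun U : GaugeConfig 4 (2 * L + 1) G => plane G r q x (torusLift (2 * L + 1) U) := by
  haveI : SecondCountableTopology G :=
    (r.continuous.isClosedEmbedding r.injective).isEmbedding.secondCountableTopology
  exact ((measurable_plaquetteObs r.ρ r.continuous 0 q.1 q.2).comp
    (Literature.MathematicalPhysics.QuantumLattice.configShift _).measurable).comp (measurable_torusLift _)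

/-- Products of centred plane fields (read through the lift) are integrable for Wilson's measure. -/
theorem integrable_prod_plane_sub (r : LatticeRep G) (β : ℝ) (L : ℕ) {n : ℕ} (q : Fin n → Fin 4 × Fin 4)
    (x : Fin n → (Fin 4 → ℤ)) (c : Fin n → ℝ) :
    Integrable (fun U : GaugeConfig 4 (2 * L + 1) G =>
        ∏ i, (plane G r (q i) (x i) (torusLift (2 * L + 1) U) - c i))
      (wilsonMeasure (d := 4) (L := 2 * L + 1) r.ρ β) := by
  haveI := isProbabilityMeasure_wilsonMeasure (d := 4) (L := 2 * L + 1) r.ρ r.continuous β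
  obtain ⟨C, hC⟩ := exists_abs_plane_le (G := G) r
  have hmeas : ∀ i, Measurable fun U : GaugeConfig 4 (2 * L + 1) G =>
      plane G r (q i) (x i) (torusLift (2 * L + 1) U) - c i := fun i =>
    (measurable_plane_lift r L (q i) (x i)).sub measurable_const
  refine Integrable.of_bound (C := ∏ i, (|C| + |c i|))
    (Finset.measurable_prod _ fun i _ => hmeas i).aestronglyMeasurable ?_
  refine Eventually.of_forall fun U => ?_
  rw [Real.norm_eq_abs, Finset.abs_prod]
  exact Finset.prod_le_prod (fun _ _ => abs_nonneg _) fun i _ =>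
    (abs_sub _ _).trans (add_le_add ((hC _ _ _).trans (le_abs_self C)) le_rfl)

/-- The single centred plane field is integrable. -/
theorem integrable_plane_lift (r : LatticeRep G) (β : ℝ) (L : ℕ) (q : Fin 4 × Fin 4) (x : Fin 4 → ℤ) :
    Integrable (fun U : GaugeConfig 4 (2 * L + 1) G => plane G r q x (torusLift (2 * L + 1) U))
      (wilsonMeasure (d := 4) (L := 2 * L + 1) r.ρ β) := by
  have h := integrable_prod_plane_sub r β L (fun _ : Fin 1 => q) (fun _ => x) (fun _ => 0)
  refine h.congr (Eventually.of_forall fun U => ?_)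
  simp

/-- **The torus mean of the density is the sum of the six plane means.** -/
theorem torusE_dens_eq_sum (r : LatticeRep G) (β : ℝ) (L : ℕ) (x : Fin 4 → ℤ) :
    torusE G r β L (dens G r x) =
      ∑ q ∈ Finset.univ.filter (fun q : Fin 4 × Fin 4 => q.1 < q.2), torusE G r β L (plane G r q x) := by
  unfold torusE
  rw [← integral_finsetSum _ (fun q _ => integrable_plane_lift r β L q x)]
  exact integral_congr_ae (Eventually.of_forall fun U => dens_eq_sum_filter_plane r x _)

/-- **The centred density is the sum of the six centred plane fields.** -/
theorem dens_sub_torusE_eq_sum (r : LatticeRep G) (β : ℝ) (L : ℕ) (x : Fin 4 → ℤ)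
    (U : GaugeConfig 4 (2 * L + 1) G) :
    dens G r x (torusLift (2 * L + 1) U) - torusE G r β L (dens G r x) =
      ∑ q ∈ Finset.univ.filter (fun q : Fin 4 × Fin 4 => q.1 < q.2),
        (plane G r q x (torusLift (2 * L + 1) U) - torusE G r β L (plane G r q x)) := by
  rw [Finset.sum_sub_distrib, ← dens_eq_sum_filter_plane, ← torusE_dens_eq_sum]

/-- **`MomentBounds6 ⇒ MomentBounds`** with constant `6C`. -/
theorem momentBounds_of_momentBounds6 (r : LatticeRep G) (a : ℝ → ℝ) (h : MomentBounds6 G r a) :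
    MomentBounds G r a := by
  classical
  obtain ⟨C, β₄, ℓ₄, hℓ, hC, H⟩ := h
  refine ⟨6 * C, β₄, ℓ₄, hℓ, by positivity, fun β hβ L n x R hR hRa hRL hsep => ?_⟩
  set P : Finset (Fin 4 × Fin 4) := Finset.univ.filter (fun q : Fin 4 × Fin 4 => q.1 < q.2) with hP
  -- expand the product of the six-term sums
  have hexp : ∀ U : GaugeConfig 4 (2 * L + 1) G,
      ∏ i, (dens G r (x i) (torusLift (2 * L + 1) U) - torusE G r β L (dens G r (x i))) =
        ∑ q ∈ Fintype.piFinset (fun _ : Fin n => P),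
          ∏ i, (plane G r (q i) (x i) (torusLift (2 * L + 1) U) - torusE G r β L (plane G r (q i) (x i))) := by
    intro U
    simp_rw [dens_sub_torusE_eq_sum r β L]
    rw [Finset.prod_univ_sum]
  -- integrate termwise
  have hint : torusE G r β L (fun V => ∏ i, (dens G r (x i) V - torusE G r β L (dens G r (x i)))) =
      ∑ q ∈ Fintype.piFinset (fun _ : Fin n => P),
        torusE G r β L (fun V => ∏ i, (plane G r (q i) (x i) V - torusE G r β L (plane G r (q i) (x i)))) := by
    unfold torusE
    rw [← integral_finsetSum _ (fun q _ => integrable_prod_plane_sub r β L q x _)]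
    exact integral_congr_ae (Eventually.of_forall fun U => hexp U)
  rw [hint]
  -- each term is bounded by `(C/R⁴)ⁿ`, there are `6ⁿ` of them
  have hterm : ∀ q ∈ Fintype.piFinset (fun _ : Fin n => P),
      |torusE G r β L (fun V => ∏ i, (plane G r (q i) (x i) V - torusE G r β L (plane G r (q i) (x i))))| ≤
        (C / (R : ℝ) ^ 4) ^ n := by
    intro q hq
    refine H β hβ L n q x R (fun i => ?_) hR hRa hRL hsep
    have := Fintype.mem_piFinset.1 hq i
    rw [hP, Finset.mem_filter] at this
    exact this.2
  calc |∑ q ∈ Fintype.piFinset (fun _ : Fin n => P),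
        torusE G r β L (fun V => ∏ i, (plane G r (q i) (x i) V - torusE G r β L (plane G r (q i) (x i))))|
      ≤ ∑ q ∈ Fintype.piFinset (fun _ : Fin n => P),
        |torusE G r β L (fun V => ∏ i, (plane G r (q i) (x i) V - torusE G r β L (plane G r (q i) (x i))))| :=
        Finset.abs_sum_le_sum_abs _ _
    _ ≤ ∑ _q ∈ Fintype.piFinset (fun _ : Fin n => P), (C / (R : ℝ) ^ 4) ^ n := Finset.sum_le_sum hterm
    _ = 6 ^ n * (C / (R : ℝ) ^ 4) ^ n := by
        rw [Finset.sum_const, nsmul_eq_mul, Fintype.card_piFinset, Finset.prod_const, Finset.card_univ,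
          Fintype.card_fin, hP, card_planes]
        push_cast
        ring
    _ = (6 * C / (R : ℝ) ^ 4) ^ n := by rw [← mul_pow, mul_div_assoc]

end Summit.QuantumFields.YangMills.Theorems.OSLegsFromFemtoAndGap

end
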